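import Literature.NumberTheory.DiophantineGeometry.WeilPairingRationalTateModuleHoldsProofs
import HarnessLib

/-!
# The `ℓ`-adic Weil pairing on `V_p B` PINNED to the level pairings `ē_{pᵏ}^Θ` of a given ample divisor `Θ`

`Proofs`-style sibling (theorems only; no definition, no named fact, no instance, no `sorry`) of ★
`WeilPairingRationalTateModuleHoldsProofs` (discharge of `weilPairing_rationalTateModule`, Milne 1986 §16 / Lang VII §2 / Mumford §20).
That file proves the EXISTENCE of a non-degenerate alternating `Γ_K`-equivariant `ℚ_p`-bilinear form on `V_p B` by choosing SOME ample
divisor internally; the present file re-runs its assembly for a GIVEN ample, Galois-invariant divisor `Θ` on `B_{K̄}` and a GIVEN coordinate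
`c : ℤ_p(1) → ℤ_p` of the Tate twist, and KEEPS THE PIN: the form `e` is, on the lattice `T_p B ⊂ V_p B`, the coordinate `c` of the
`ℤ_p(1)`-valued pairing `W.tatePairing` whose level-`pᵏ` components are the level Weil pairings `ē_{pᵏ}^Θ` of [Milne1986AbelianVarieties, §16
(p. 131–132), Lemma 16.1] (tree ★ `Motives/AbelianVarietyWeilPairingLevel.weilPairingLevel Θ`).  This is the per-level producer the tower road
(P) of the cell `hodgecm-mathlib` consumes (d6 S2′ socket `SocketRos`, legs (T2b) `EtaleH1TowerPairing` / (T3); A-plan2 (g12) s211 hand (2)):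
with ONE `c` for all levels the forms are comparable across the tower, and identities proved on `ē^Θ` (e.g. the norm/pull-back adjointness
of a Galois cover) transport to `e` mechanically through `toMul_proj_tatePairing`.

* §1 `exists_bilinForm_rationalTateModule_pinned` — ★ `exists_bilinForm_rationalTateModule` (base change `T_p → V_p`) with the extra
  conjunct `e (1 ⊗ t) (1 ⊗ t') = E t t'` (Milne §16 «`e_l^λ` … on `V_l A = T_l A ⊗ ℚ_l`»).
* §2 `exists_levelWeilPairing_eq_weilPairingLevel` — for `Θ` ample and Galois invariant on `B_{K̄}`, a `LevelWeilPairing` whose pairings ARE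
  `ē_{pᵏ}^Θ` on `B.torsionPt` (★ §5 of the `Holds` file with `Θ` given instead of chosen).
* §3 **`exists_bilinForm_rationalTateModule_of_isAmple`** — the pinned form: `∃ W e, (W.e k = ē_{pᵏ}^Θ) ∧ (e ∘ toRational = c ∘ W.tatePairing)
  ∧ e.IsAlt ∧ e.Nondegenerate ∧ e (g x, g y) = χ_p(g) e (x, y)`; and `…_of_isAmple_pullback` for `Θ = pr₁^* Θ₀`, `Θ₀` ample on `B`
  (ampleness ★ `CartierDivisor.IsAmple.pullback`, invariance ★ `pullback_fstX_galX_sameDivisor`).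

HC_CM is proved only modulo the 7 printed citations until rung 0 closes; this file moves no book and introduces no named fact.

## References
* [Milne1986AbelianVarieties] J. S. Milne, *Abelian varieties*, in Cornell–Silverman (eds.), *Arithmetic Geometry* (1986), §16 «Pairings»:
  `ē_m` (p. 131), Lemma 16.1, `e_l^λ` on `V_l A` (p. 132), Lemma 16.2 (pp. 131–132).
* [Lang1983AbelianVarieties] S. Lang, *Abelian Varieties* (1959/1983), Ch. VII §2, Props. 2–7 and Thm. 5.
* [MumfordAV1970] D. Mumford, *Abelian Varieties* (1970), §20 (the `e_n`-pairing, Riemann forms).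
-/

set_option autoImplicit false

noncomputable section

open scoped Classical
open scoped AddSubgroup TensorProduct

open AlgebraicGeometry CategoryTheory Function

namespace Literature.NumberTheory.DiophantineGeometry

open Literature.NumberTheory.EllipticCurves Literature.NumberTheory.GaloisRepresentations
open Literature.AlgebraicGeometry.Motives (AbelianVariety)

universe u v

/-! ## §1 Base change `T_p → V_p` keeping the pin -/

section Rational

variable {K : Type u} [Field K] {A : Type v} [AddCommGroup A]
  [DistribMulAction (Field.absoluteGaloisGroup K) A] (p : ℕ) [Fact p.Prime]

/-- **Base change of a Weil pairing `E` on `T_p A` to `V_p A`, PINNED**: the form `e = ℚ_p ⊗ E` satisfies `e (1 ⊗ t, 1 ⊗ t') = E (t, t')`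
and is alternating, non-degenerate and `Γ_K`-equivariant with the cyclotomic character when `E` is alternating with zero left radical and
`χ_p`-equivariant (★ `exists_bilinForm_rationalTateModule`, whose proof this is, with the first conjunct kept).
[cite: Milne1986AbelianVarieties, §16 (e_l^λ on V_l A = T_l A ⊗ ℚ_l, p. 132) and Lemma 16.2] -/
theorem exists_bilinForm_rationalTateModule_pinned (E : LinearMap.BilinForm ℤ_[p] (TateModule A p))
    (halt : ∀ t, E t t = 0) (hrad : ∀ t, (∀ t', E t t' = 0) → t = 0)
    (hgal : ∀ (σ : Field.absoluteGaloisGroup K) (t t' : TateModule A p),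
      E (σ • t) (σ • t') = ((GaloisRep.cyclotomicCharacter K p σ : ℤ_[p]ˣ) : ℤ_[p]) * E t t') :
    ∃ e : LinearMap.BilinForm ℚ_[p] (RationalTateModule A p),
      (∀ t t' : TateModule A p, e (TateModule.toRational p t) (TateModule.toRational p t') = (E t t' : ℚ_[p])) ∧
      e.IsAlt ∧ e.Nondegenerate ∧
      ∀ (g : Field.absoluteGaloisGroup K) (x y : RationalTateModule A p),
        e (rationalTateRepresentation (Field.absoluteGaloisGroup K) A p g x)
            (rationalTateRepresentation (Field.absoluteGaloisGroup K) A p g y) =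
          (((GaloisRep.cyclotomicCharacter K p g : ℤ_[p]ˣ) : ℤ_[p]) : ℚ_[p]) * e x y := by
  let eV : LinearMap.BilinForm ℚ_[p] (RationalTateModule A p) :=
    (E.baseChange ℚ_[p] : LinearMap.BilinForm ℚ_[p] (ℚ_[p] ⊗[ℤ_[p]] TateModule A p))
  have heV : ∀ (a a' : ℚ_[p]) (t t' : TateModule A p),
      eV ((a ⊗ₜ[ℤ_[p]] t : ℚ_[p] ⊗[ℤ_[p]] TateModule A p) : RationalTateModule A p)
        ((a' ⊗ₜ[ℤ_[p]] t' : ℚ_[p] ⊗[ℤ_[p]] TateModule A p) : RationalTateModule A p) =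
        (E t t' : ℚ_[p]) * (a * a') := fun a a' t t' => by
    change E.baseChange ℚ_[p] (a ⊗ₜ[ℤ_[p]] t) (a' ⊗ₜ[ℤ_[p]] t') = _
    rw [LinearMap.BilinForm.baseChange_tmul, Algebra.smul_def]
    rfl
  have htoR : ∀ t t' : TateModule A p,
      eV (TateModule.toRational p t) (TateModule.toRational p t') = (E t t' : ℚ_[p]) := fun t t' => by
    rw [TateModule.toRational_apply, TateModule.toRational_apply, heV, mul_one, mul_one]
  -- alternating
  have hAlt : eV.IsAlt := by
    intro x
    obtain ⟨t, s, hs, hsx⟩ := exists_smul_eq_toRational p x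
    have hs' : (s : ℚ_[p]) ≠ 0 := fun h0 => hs (PadicInt.coe_eq_zero.mp h0)
    have h1 : eV ((s : ℚ_[p]) • x) ((s : ℚ_[p]) • x) = (s : ℚ_[p]) * ((s : ℚ_[p]) * eV x x) := by
      rw [LinearMap.BilinForm.smul_left, LinearMap.BilinForm.smul_right]
    rw [hsx, htoR, halt, PadicInt.coe_zero] at h1
    have h2 := h1.symm
    rcases mul_eq_zero.mp h2 with h | h
    · exact absurd h hs'
    · rcases mul_eq_zero.mp h with h | h
      · exact absurd h hs'
      · exact h
  -- left radical
  have hSepL : eV.SeparatingLeft := by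
    intro x hx
    obtain ⟨t, s, hs, hsx⟩ := exists_smul_eq_toRational p x
    have hs' : (s : ℚ_[p]) ≠ 0 := fun h0 => hs (PadicInt.coe_eq_zero.mp h0)
    have ht : t = 0 := by
      refine hrad t fun t' => ?_
      have h1 : eV ((s : ℚ_[p]) • x) (TateModule.toRational p t') = 0 := by
        rw [LinearMap.BilinForm.smul_left, hx, mul_zero]
      rw [hsx, htoR] at h1
      exact PadicInt.coe_eq_zero.mp h1
    rw [ht, map_zero] at hsx
    rcases smul_eq_zero.mp hsx with h | h
    · exact absurd h hs'
    · exact h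
  refine ⟨eV, htoR, hAlt, ⟨hSepL, fun y hy => hSepL y fun x => ?_⟩, fun g x y => ?_⟩
  · rw [← hAlt.neg_eq, hy, neg_zero]
  · suffices h : ∀ x' y' : ℚ_[p] ⊗[ℤ_[p]] TateModule A p,
        E.baseChange ℚ_[p]
            ((tateRepresentation (Field.absoluteGaloisGroup K) A p g).baseChange ℚ_[p] x')
            ((tateRepresentation (Field.absoluteGaloisGroup K) A p g).baseChange ℚ_[p] y') =
          (((GaloisRep.cyclotomicCharacter K p g : ℤ_[p]ˣ) : ℤ_[p]) : ℚ_[p]) *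
            E.baseChange ℚ_[p] x' y' from h x y
    intro x' y'
    induction x' using TensorProduct.induction_on with
    | zero => simp only [map_zero, LinearMap.zero_apply, mul_zero]
    | add x₁ x₂ hx₁ hx₂ => simp only [map_add, LinearMap.add_apply, hx₁, hx₂, mul_add]
    | tmul a t =>
      induction y' using TensorProduct.induction_on with
      | zero => simp only [map_zero, mul_zero]
      | add y₁ y₂ hy₁ hy₂ => simp only [map_add, hy₁, hy₂, mul_add]
      | tmul a' t' =>
        rw [LinearMap.baseChange_tmul, LinearMap.baseChange_tmul,
          LinearMap.BilinForm.baseChange_tmul, LinearMap.BilinForm.baseChange_tmul,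
          tateRepresentation_apply_apply, tateRepresentation_apply_apply, hgal, Algebra.smul_def,
          Algebra.smul_def, map_mul, mul_assoc]
        rfl

end Rational

/-! ## §2 The level Weil pairings of a GIVEN ample, Galois-invariant divisor on `B_{K̄}` -/

section Geometric

open Literature.AlgebraicGeometry.Motives Literature.AlgebraicGeometry.Motives.AbelianVariety RatFn

variable {K : Type u} [Field K] (B : AbelianVariety K) (p : ℕ) [Fact p.Prime]

/-- **A `LevelWeilPairing` on `B(K̄)` whose pairings ARE the level Weil pairings `ē_{pᵏ}^Θ`** of a given ample divisor `Θ` on `B_{K̄}`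
invariant under `Gal(K̄/K)` (★ `exists_levelFun`, `levelFun_*` of the `Holds` file: `μ`-valued, biadditive, alternating, Galois
equivariant, level compatible, radicals killed by `p^{#K(Θ)}`). [cite: Milne1986AbelianVarieties, §16 (p. 131, the pairings ē_m) and Lemma 16.1]
[cite: Lang1983AbelianVarieties, Ch. VII §2 Props. 3–5] -/
theorem exists_levelWeilPairing_eq_weilPairingLevel (hp : (p : K) ≠ 0)
    (Θ : CartierDivisor (B.baseChange (AlgebraicClosure K)).X.left) (hΘ : Θ.IsAmple)
    (hΘinv : ∀ τ : AlgebraicClosure K ≃ₐ[K] AlgebraicClosure K,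
      (Θ.pullback (B.galX (AlgebraicClosure K) τ)).SameDivisor Θ) :
    ∃ W : LevelWeilPairing K B.geomPoints p,
      ∀ (k : ℕ) (x y : B.geomPoints) (hx : (Additive.toMul x : B.Points (AlgebraicClosure K)) ^ p ^ k = 1)
        (hy : (Additive.toMul y : B.Points (AlgebraicClosure K)) ^ p ^ k = 1),
        haveI : IsDominant (Hom.toSchemeHom (((p ^ k : ℕ) : ℤ) • 𝟙 (B.baseChange (AlgebraicClosure K)))) :=
          isDominant_natCast_zsmul_baseChange B (p ^ k) (pow_ne_zero k (Fact.out : p.Prime).ne_zero)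
        W.e k x y = (B.baseChange (AlgebraicClosure K)).weilPairingLevel (N := p ^ k) Θ
          (B.torsionPt (AlgebraicClosure K) hx) (B.torsionPt (AlgebraicClosure K) hy) := by
  have hpr : p.Prime := Fact.out
  haveI hdom : ∀ k : ℕ,
      IsDominant (Hom.toSchemeHom (((p ^ k : ℕ) : ℤ) • 𝟙 (B.baseChange (AlgebraicClosure K)))) :=
    fun k => isDominant_natCast_zsmul_baseChange B (p ^ k) (pow_ne_zero k hpr.ne_zero)
  obtain ⟨e, he⟩ := exists_levelFun B p Θ
  obtain ⟨c, hc⟩ := levelFun_exists_radical_le B p _ e he hp hΘ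
  exact ⟨{ e := e
           pow_eq_one := levelFun_pow_eq_one B p _ e he
           add_left := levelFun_add_left B p _ e he
           add_right := levelFun_add_right B p _ e he
           self_eq_one := levelFun_self_eq_one B p _ e he
           smul_eq := levelFun_smul_eq B p _ e he hΘinv
           pow_succ_eq := levelFun_pow_succ_eq B p _ e he
           exists_radical_le := ⟨c, hc⟩ }, fun k x y hx hy => he k x y hx hy⟩

/-! ## §3 The pinned form on `V_p B` -/

/-- **The `ℓ`-adic Weil pairing of `Θ` on `V_p B`, pinned to `ē_{pᵏ}^Θ`.**  For an abelian variety `B / K`, a prime `p` invertible in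
`K`, a coordinate `c : ℤ_p(1) → ℤ_p` of the Tate twist (injective; ★ `exists_injective_tateTwistCoord`), and an ample `Gal(K̄/K)`-invariant
divisor `Θ` on `B_{K̄}`: there are a `LevelWeilPairing` `W` with `W.e k = ē_{pᵏ}^Θ` on torsion points and a `ℚ_p`-bilinear form `e` on
`V_p B` with `e (1 ⊗ t, 1 ⊗ t') = c (W.tatePairing t t')` (so `proj_k` of `W.tatePairing t t'` is `ē_{pᵏ}^Θ(t_k, t'_k)`, ★ `toMul_proj_tatePairing`),
alternating, non-degenerate, and `Γ_K`-equivariant with the cyclotomic character — the conclusion of ★ `weilPairing_rationalTateModule` with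
its construction exposed. [cite: Milne1986AbelianVarieties, §16 Lemma 16.1–16.2 (pp. 131–132)] [cite: Lang1983AbelianVarieties, Ch. VII §2 Thm. 5] -/
theorem exists_bilinForm_rationalTateModule_of_isAmple (hp : (p : K) ≠ 0)
    (c : TateModule (Additive (AlgebraicClosure K)ˣ) p →ₗ[ℤ_[p]] ℤ_[p]) (hc : Injective c)
    (Θ : CartierDivisor (B.baseChange (AlgebraicClosure K)).X.left) (hΘ : Θ.IsAmple)
    (hΘinv : ∀ τ : AlgebraicClosure K ≃ₐ[K] AlgebraicClosure K,
      (Θ.pullback (B.galX (AlgebraicClosure K) τ)).SameDivisor Θ) :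
    ∃ (W : LevelWeilPairing K B.geomPoints p) (e : LinearMap.BilinForm ℚ_[p] (B.rationalTateModule p)),
      (∀ (k : ℕ) (x y : B.geomPoints) (hx : (Additive.toMul x : B.Points (AlgebraicClosure K)) ^ p ^ k = 1)
          (hy : (Additive.toMul y : B.Points (AlgebraicClosure K)) ^ p ^ k = 1),
          haveI : IsDominant (Hom.toSchemeHom (((p ^ k : ℕ) : ℤ) • 𝟙 (B.baseChange (AlgebraicClosure K)))) :=
            isDominant_natCast_zsmul_baseChange B (p ^ k) (pow_ne_zero k (Fact.out : p.Prime).ne_zero)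
          W.e k x y = (B.baseChange (AlgebraicClosure K)).weilPairingLevel (N := p ^ k) Θ
            (B.torsionPt (AlgebraicClosure K) hx) (B.torsionPt (AlgebraicClosure K) hy)) ∧
      (∀ t t' : TateModule B.geomPoints p,
          e (TateModule.toRational p t) (TateModule.toRational p t') = ((c (W.tatePairing t t') : ℤ_[p]) : ℚ_[p])) ∧
      e.IsAlt ∧ e.Nondegenerate ∧
      ∀ (g : Field.absoluteGaloisGroup K) (x y : B.rationalTateModule p),
        e (B.rationalTateRep p g x) (B.rationalTateRep p g y) =
          (((GaloisRep.cyclotomicCharacter K p g : ℤ_[p]ˣ) : ℤ_[p]) : ℚ_[p]) * e x y := by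
  haveI : NeZero (p : K) := ⟨hp⟩
  obtain ⟨W, hW⟩ := exists_levelWeilPairing_eq_weilPairingLevel B p hp Θ hΘ hΘinv
  -- the projections `T_p B → B[pᵏ]` are onto (`B(K̄)` is divisible)
  have hproj : ∀ k, ∀ y ∈ (B.geomPoints)[(p ^ k : ℕ)],
      ∃ t : TateModule B.geomPoints p, TateModule.proj p k t = y := fun k y hy =>
    TateModule.exists_proj_eq_of_smul_surjective
      (B.nsmul_geomPoints_surjective_of_ne_zero p (Fact.out : p.Prime).ne_zero) k hy
  -- the `ℤ_p`-valued form `E := c ∘ W.tatePairing` (as in ★ `LevelWeilPairing.exists_bilinForm_tateModule`)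
  set E : LinearMap.BilinForm ℤ_[p] (TateModule B.geomPoints p) := W.tatePairing.compr₂ c with hE
  have h1 : ∀ t, E t t = 0 := fun t => by
    rw [hE, LinearMap.compr₂_apply, LevelWeilPairing.tatePairing_self, map_zero]
  have h2 : ∀ t, (∀ t', E t t' = 0) → t = 0 := fun t ht => by
    refine W.eq_zero_of_forall_tatePairing_eq_zero hproj fun t' => hc ?_
    rw [map_zero]
    have := ht t'
    rwa [hE, LinearMap.compr₂_apply] at this
  have h3 : ∀ (σ : Field.absoluteGaloisGroup K) (t t' : TateModule B.geomPoints p),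
      E (σ • t) (σ • t') = ((GaloisRep.cyclotomicCharacter K p σ : ℤ_[p]ˣ) : ℤ_[p]) * E t t' := fun σ t t' => by
    rw [hE, LinearMap.compr₂_apply, LinearMap.compr₂_apply, LevelWeilPairing.tatePairing_smul, map_smul, smul_eq_mul]
  obtain ⟨e, hpin, hAlt, hNd, hGal⟩ := exists_bilinForm_rationalTateModule_pinned p E h1 h2 h3
  refine ⟨W, e, hW, fun t t' => ?_, hAlt, hNd, hGal⟩
  rw [hpin t t', hE, LinearMap.compr₂_apply]

/-- **The same for `Θ = pr₁^* Θ₀`, `Θ₀` an ample divisor of `B`** (ample on `B_{K̄}` by ★ `CartierDivisor.IsAmple.pullback`, Galois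
invariant by ★ `pullback_fstX_galX_sameDivisor`): the `ℓ`-adic Weil pairing of a `K`-RATIONAL polarisation, pinned to its level pairings.
[cite: Milne1986AbelianVarieties, §16 Lemma 16.1–16.2 (pp. 131–132)] -/
theorem exists_bilinForm_rationalTateModule_of_isAmple_pullback (hp : (p : K) ≠ 0)
    (c : TateModule (Additive (AlgebraicClosure K)ˣ) p →ₗ[ℤ_[p]] ℤ_[p]) (hc : Injective c)
    (Θ₀ : CartierDivisor B.X.left) (hΘ₀ : Θ₀.IsAmple) :
    ∃ (W : LevelWeilPairing K B.geomPoints p) (e : LinearMap.BilinForm ℚ_[p] (B.rationalTateModule p)),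
      (∀ (k : ℕ) (x y : B.geomPoints) (hx : (Additive.toMul x : B.Points (AlgebraicClosure K)) ^ p ^ k = 1)
          (hy : (Additive.toMul y : B.Points (AlgebraicClosure K)) ^ p ^ k = 1),
          haveI : IsDominant (Hom.toSchemeHom (((p ^ k : ℕ) : ℤ) • 𝟙 (B.baseChange (AlgebraicClosure K)))) :=
            isDominant_natCast_zsmul_baseChange B (p ^ k) (pow_ne_zero k (Fact.out : p.Prime).ne_zero)
          W.e k x y = (B.baseChange (AlgebraicClosure K)).weilPairingLevel (N := p ^ k) (Θ₀.pullback (B.fstX (AlgebraicClosure K)))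
            (B.torsionPt (AlgebraicClosure K) hx) (B.torsionPt (AlgebraicClosure K) hy)) ∧
      (∀ t t' : TateModule B.geomPoints p,
          e (TateModule.toRational p t) (TateModule.toRational p t') = ((c (W.tatePairing t t') : ℤ_[p]) : ℚ_[p])) ∧
      e.IsAlt ∧ e.Nondegenerate ∧
      ∀ (g : Field.absoluteGaloisGroup K) (x y : B.rationalTateModule p),
        e (B.rationalTateRep p g x) (B.rationalTateRep p g y) =
          (((GaloisRep.cyclotomicCharacter K p g : ℤ_[p]ˣ) : ℤ_[p]) : ℚ_[p]) * e x y :=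
  exists_bilinForm_rationalTateModule_of_isAmple B p hp c hc _ (hΘ₀.pullback _)
    (B.pullback_fstX_galX_sameDivisor (AlgebraicClosure K) Θ₀)

end Geometric

end Literature.NumberTheory.DiophantineGeometry

end
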